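import Mathlib
import Summits.PneNP.PneNP.Theses.PhaseTwins
import Literature.Computability.Complexity.HardcoreInapproximability
import Literature.ModelTheory.FiniteModelTheory.XorLocalConsistency
import Literature.ModelTheory.FiniteModelTheory.AtseriasDawar3Xor

/-!
# Sketch — crux-ideate stmt-PneNP-2720 (`MacroscopicTwinsAbove`), ideator 3, round 1

First lemmas of the two idea cards, stated over existing declarations (and, for card 2, over a
ten-line local definition of the FGLSS conflict graph). Everything here must ELABORATE; the
analytic first lemma of card 1 (`fixedGadget_macroscopicCut`) and the transfer
`LinearDepthMacroscopicTwins → MacroscopicTwinsAbove` are PROVED.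
-/

namespace Summit.PneNP.PneNP.Cruxes.MacroscopicTwinsAbove.Sketch

open Literature.Computability.Complexity Literature.Probability.LatticeModels
open Literature.ModelTheory.FiniteModelTheory
open Finset

/-! ## Card 1 (`hypergraph-tseitin-fixed-gadget`) — analytic first lemma

MACROSCOPIC CUT GAP AT FIXED GADGET SIZE. The tree's `cutProb_bounds_of_slyPropB` is already the
linear-rate sandwich `(1±δ)^N` valid for EVERY `N` (no `N ≤ n^{θ/4}`), and `phaseProbs_of_slyPropA`
loses only `n^{-N}`. Hence ONE fixed gadget (size parameter `n`, port error `δ < 1`) turns a max-cut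
gap `g = maxcut H₀ - maxcut H₁` into the partition-function ratio
`Z(H₀^G)/Z(H₁^G) ≥ ((1-δ)/((1+δ)n))^N · B^{κ g}` — macroscopic (`e^{Θ(N)}`) as soon as
`κ g log B > N log((1+δ)n/(1-δ))`, i.e. for a LINEAR cut gap and `κ = O(log n)` parallel port edges.
No "second threshold": the `e^{o(n)}` of GŠV/Sly is an artefact of the exact-MAX-CUT decoding regime. -/

open scoped Classical in
/-- **Fixed-gadget macroscopic cut lemma** (card 1, first lemma; PROVED from tree lemmas). -/
theorem fixedGadget_macroscopicCut {V : Type*} [Fintype V] [DecidableEq V] {N κ m : ℕ}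
    (H₀ H₁ : SimpleGraph (Fin N)) (G : SimpleGraph V) (Vp Vm : Fin m ↪ V)
    (ι : Fin N × Fin κ ↪ Fin m) {lam : ℝ} (hlam : 0 ≤ lam) (Wp Wm : Finset V)
    {qp qm δ : ℝ} (hqm : 0 < qm) (hlt : qm < qp) (hqp : qp < 1) (hδ0 : 0 ≤ δ) (hδ1 : δ < 1)
    {n : ℕ} (hn : 0 < n) (hA : SlyPropA G lam Wp Wm n)
    (hB : SlyPropB G lam Wp Wm Vp Vm qp qm δ)
    (hE : H₀.edgeFinset.card = H₁.edgeFinset.card) (hmc : maxCut H₁ ≤ maxCut H₀) :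
    ((1 - δ) / ((1 + δ) * n)) ^ N * slyB qp qm ^ (κ * (maxCut H₀ - maxCut H₁)) *
        independencePolynomial (gadgetSubst H₁ G Vp Vm ι) lam ≤
      independencePolynomial (gadgetSubst H₀ G Vp Vm ι) lam := by
  have hB1 : 1 ≤ slyB qp qm := (one_lt_slyB hqm hlt hqp).le
  have hCpos : 0 < slyC qp qm κ H₀.edgeFinset.card := slyC_pos hqm hlt hqp _ _
  have hnpos : (0 : ℝ) < n := by exact_mod_cast hn
  have hZb0 : 0 ≤ independencePolynomial (gadgetSubst ⊥ G Vp Vm ι) lam :=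
    (independencePolynomial_pos _ hlam).le
  -- Step A: `Z_{H₁^G} ≤ (1+δ)^N C B^{κ maxcut H₁} Z_{Ĥ^G}` (sum the upper sandwich over phase vectors)
  have hup : independencePolynomial (gadgetSubst H₁ G Vp Vm ι) lam ≤
      (1 + δ) ^ N * (slyC qp qm κ H₀.edgeFinset.card * slyB qp qm ^ (κ * maxCut H₁) *
        independencePolynomial (gadgetSubst ⊥ G Vp Vm ι) lam) := by
    rw [← sum_hardcoreZOn_fiber (gadgetSubst H₁ G Vp Vm ι) lam (phaseVec Wp Wm),
      ← sum_hardcoreZOn_fiber (gadgetSubst ⊥ G Vp Vm ι) lam (phaseVec Wp Wm), Finset.mul_sum,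
      Finset.mul_sum]
    refine Finset.sum_le_sum fun Y _ => ?_
    have hY := (cutProb_bounds_of_slyPropB H₁ G Vp Vm ι hlam Wp Wm hqm hlt hqp hδ1.le hB Y).2
    rw [← hE] at hY
    have hZ0 : 0 ≤ hardcoreZOn (gadgetSubst ⊥ G Vp Vm ι) lam (fun I => phaseVec Wp Wm I = Y) :=
      hardcoreZOn_nonneg _ hlam _
    have hpow : slyB qp qm ^ (κ * cutSize H₁ Y) ≤ slyB qp qm ^ (κ * maxCut H₁) :=
      pow_le_pow_right₀ hB1 (Nat.mul_le_mul_left _ (cutSize_le_maxCut H₁ Y))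
    have h1δ : 0 ≤ (1 + δ) ^ N := pow_nonneg (by linarith) _
    calc hardcoreZOn (gadgetSubst H₁ G Vp Vm ι) lam (fun I => phaseVec Wp Wm I = Y)
        ≤ (1 + δ) ^ N * (slyC qp qm κ H₀.edgeFinset.card * slyB qp qm ^ (κ * cutSize H₁ Y) *
            hardcoreZOn (gadgetSubst ⊥ G Vp Vm ι) lam (fun I => phaseVec Wp Wm I = Y)) := hY
      _ ≤ (1 + δ) ^ N * (slyC qp qm κ H₀.edgeFinset.card * slyB qp qm ^ (κ * maxCut H₁) *
            hardcoreZOn (gadgetSubst ⊥ G Vp Vm ι) lam (fun I => phaseVec Wp Wm I = Y)) := by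
          gcongr
  -- Step B: at a maximum cut `Y₀` of `H₀`, the lower sandwich and `(phaseProbs)`
  obtain ⟨Y₀, hY₀⟩ := exists_cutSize_eq_maxCut H₀
  have hlowB := (cutProb_bounds_of_slyPropB H₀ G Vp Vm ι hlam Wp Wm hqm hlt hqp hδ1.le hB Y₀).1
  have hphase := phaseProbs_of_slyPropA G Vp Vm ι hlam Wp Wm hA Y₀
  -- Step C: algebra
  have hBpow : slyB qp qm ^ (κ * (maxCut H₀ - maxCut H₁)) * slyB qp qm ^ (κ * maxCut H₁) =
      slyB qp qm ^ (κ * maxCut H₀) := by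
    rw [← pow_add, ← Nat.mul_add, Nat.sub_add_cancel hmc]
  have h1δne : (1 + δ) ^ N ≠ 0 := pow_ne_zero _ (by linarith)
  have hnN : (n : ℝ) ^ N ≠ 0 := pow_ne_zero _ hnpos.ne'
  have hpref : 0 ≤ ((1 - δ) / ((1 + δ) * n)) ^ N * slyB qp qm ^ (κ * (maxCut H₀ - maxCut H₁)) := by
    have : 0 ≤ (1 - δ) / ((1 + δ) * n) := div_nonneg (by linarith) (by positivity)
    positivity
  calc ((1 - δ) / ((1 + δ) * n)) ^ N * slyB qp qm ^ (κ * (maxCut H₀ - maxCut H₁)) *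
        independencePolynomial (gadgetSubst H₁ G Vp Vm ι) lam
      ≤ ((1 - δ) / ((1 + δ) * n)) ^ N * slyB qp qm ^ (κ * (maxCut H₀ - maxCut H₁)) *
          ((1 + δ) ^ N * (slyC qp qm κ H₀.edgeFinset.card * slyB qp qm ^ (κ * maxCut H₁) *
            independencePolynomial (gadgetSubst ⊥ G Vp Vm ι) lam)) :=
        mul_le_mul_of_nonneg_left hup hpref
    _ = (1 - δ) ^ N * (slyC qp qm κ H₀.edgeFinset.card *
          (slyB qp qm ^ (κ * (maxCut H₀ - maxCut H₁)) * slyB qp qm ^ (κ * maxCut H₁)) *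
          (independencePolynomial (gadgetSubst ⊥ G Vp Vm ι) lam / (n : ℝ) ^ N)) := by
        rw [div_pow, mul_pow]
        field_simp
    _ = (1 - δ) ^ N * (slyC qp qm κ H₀.edgeFinset.card * slyB qp qm ^ (κ * cutSize H₀ Y₀) *
          (independencePolynomial (gadgetSubst ⊥ G Vp Vm ι) lam / (n : ℝ) ^ N)) := by
        rw [hBpow, hY₀]
    _ ≤ (1 - δ) ^ N * (slyC qp qm κ H₀.edgeFinset.card * slyB qp qm ^ (κ * cutSize H₀ Y₀) *
          hardcoreZOn (gadgetSubst ⊥ G Vp Vm ι) lam (fun I => phaseVec Wp Wm I = Y₀)) := by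
        have h1 : 0 ≤ (1 - δ) ^ N := pow_nonneg (by linarith) _
        gcongr
    _ ≤ hardcoreZOn (gadgetSubst H₀ G Vp Vm ι) lam (fun I => phaseVec Wp Wm I = Y₀) := hlowB
    _ ≤ independencePolynomial (gadgetSubst H₀ G Vp Vm ι) lam :=
        hardcoreZOn_le_independencePolynomial _ hlam _

/-! ## Card 1 — the transfer `C⁺ ⇒ crux` (and `C⁺ ⇒` the sibling crux 2719)

`C⁺ = LinearDepthMacroscopicTwins`: twins that are hom-indistinguishable up to treewidth `c·n` AND
`e^{δ n}`-separated. The hypergraph-Tseitin construction at fixed gadget size gives exactly this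
(AD19's systems are `k`-locally consistent for `k = Ω(N)`, and `n = Θ(N)`). -/

open scoped Classical in
/-- `C⁺`: linear-depth macroscopic twins above `λ_c(Δ)`. -/
def LinearDepthMacroscopicTwins : Prop :=
  ∀ Δ : ℕ, 3 ≤ Δ → ∀ lam : ℝ, ((Δ : ℝ) - 1) ^ (Δ - 1) / ((Δ : ℝ) - 2) ^ Δ < lam →
    ∃ δ : ℝ, 0 < δ ∧ ∃ c : ℝ, 0 < c ∧ ∀ n₀ : ℕ, ∃ (n : ℕ) (G H : SimpleGraph (Fin n)),
      n₀ ≤ n ∧ 0 < n ∧ G.maxDegree ≤ Δ ∧ H.maxDegree ≤ Δ ∧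
      (∀ (m : ℕ) (F : SimpleGraph (Fin m)),
          (Literature.Combinatorics.SimpleGraph.treewidth F : ℝ) < c * n →
            Nat.card (F →g G) = Nat.card (F →g H)) ∧
      Real.exp (δ * n) * (∑ I : Finset (Fin n), (if H.IsIndepSet (↑I : Set (Fin n)) then lam ^ I.card else 0)) ≤
        ∑ I : Finset (Fin n), (if G.IsIndepSet (↑I : Set (Fin n)) then lam ^ I.card else 0)

/-- **Transfer, PROVED**: `C⁺` implies the crux `MacroscopicTwinsAbove` by name. -/
theorem macroscopicTwinsAbove_of_linearDepth (h : LinearDepthMacroscopicTwins) :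
    Summit.PneNP.PneNP.Theses.PhaseTwins.MacroscopicTwinsAbove := by
  intro Δ hΔ lam hlam
  obtain ⟨δ, hδ, c, hc, hmain⟩ := h Δ hΔ lam hlam
  refine ⟨δ, hδ, fun k => ?_⟩
  obtain ⟨n, G, H, hn₀, hn, hG, hH, hhom, hZ⟩ := hmain (⌈(k : ℝ) / c⌉₊)
  refine ⟨n, G, H, hn, hG, hH, fun m F hF => hhom m F ?_, hZ⟩
  have h1 : (k : ℝ) / c ≤ n := (Nat.le_ceil _).trans (by exact_mod_cast hn₀)
  have h2 : (k : ℝ) ≤ c * n := by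
    rw [div_le_iff₀ hc] at h1
    linarith [h1]
  calc (Literature.Combinatorics.SimpleGraph.treewidth F : ℝ) < k := by exact_mod_cast hF
    _ ≤ c * n := h2

/-- **Transfer to the sibling crux** (stated; routine real analysis: `n^{1/2} ≤ c n` and
`e^{δ n} ≥ 2` for large `n`). -/
theorem polyDepthTwinsAbove_of_linearDepth (h : LinearDepthMacroscopicTwins) :
    Summit.PneNP.PneNP.Theses.PhaseTwins.PolyDepthTwinsAbove := by
  sorry

/-! ## Card 1 — combinatorial first lemma (twin source with bounded occurrence)

The tree's `AtseriasDawar2019_xorLocalGap_holds` has NO occurrence bound (scope caveat (a) of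
`AtseriasDawar3Xor.lean`). Constant-size gadgets need bounded occurrence (ports per copy
`= K · occ(x) + κ₁` must be a constant). Pruning the equations that touch a variable of occurrence
`> r` from the tree's random system keeps boundary expansion (hereditary), far-ness (few equations
removed) and gives the statement below, in the vocabulary of `XorLocalConsistency.lean`. -/

/-- Bounded-occurrence, boundary-expanding, far-from-satisfiable 3-XOR systems for every `k`
(first combinatorial stub of card 1; constants `c, r` independent of `k`). -/
def BoundedOccurrenceFarSystems : Prop :=
  ∀ ε : ℝ, 0 < ε → ∃ c r : ℕ, ∀ k : ℕ, 1 ≤ k →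
    ∃ (n m : ℕ) (S : Fin m → Finset (Fin n)) (b : Fin m → ZMod 2),
      k < n ∧ n ≤ c * k ∧ n ≤ m ∧ m ≤ c * k ∧ (∀ u, (S u).card = 3) ∧
      (∀ v : Fin n, (Finset.univ.filter fun u => v ∈ S u).card ≤ r) ∧
      (∀ T : Finset (Fin m), T.card ≤ 4 * k → T.card ≤ 2 * (XorSystem.boundary S T).card) ∧
      (∀ f : Fin n → ZMod 2,
        ((Finset.univ.filter fun u => ∑ v ∈ S u, f v = b u).card : ℝ) ≤ (1 / 2 + ε) * m)

/-! ## Card 2 (`fglss-partial-assignment-gas`) — the FGLSS conflict graph and its three lemmas -/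

section FGLSS

variable {n m : ℕ}

/-- Vertices of the FGLSS conflict graph of the system `x u + y u + z u = b u`: an equation index
with a satisfying local assignment of its three positions. -/
abbrev FVert (x y z : Fin m → Fin n) (b : Fin m → ZMod 2) : Type :=
  {p : Fin m × (ZMod 2 × ZMod 2 × ZMod 2) // p.2.1 + p.2.2.1 + p.2.2.2 = b p.1}

/-- the variable in position `i` of equation `u` -/
def fvar (x y z : Fin m → Fin n) (u : Fin m) (i : Fin 3) : Fin n := ![x u, y u, z u] i

/-- the value in position `i` of a local assignment -/
def fval (t : ZMod 2 × ZMod 2 × ZMod 2) (i : Fin 3) : ZMod 2 := ![t.1, t.2.1, t.2.2] i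

/-- **FGLSS conflict graph**: two local assignments are adjacent iff they belong to the same
equation or give different values to a common variable. -/
def fglss (x y z : Fin m → Fin n) (b : Fin m → ZMod 2) : SimpleGraph (FVert x y z b) :=
  SimpleGraph.fromRel fun p q =>
    p.1.1 = q.1.1 ∨ ∃ i j : Fin 3, fvar x y z p.1.1 i = fvar x y z q.1.1 j ∧ fval p.1.2 i ≠ fval q.1.2 j

/-- the twisted right-hand side `b + ∂f` -/
def twist (x y z : Fin m → Fin n) (b : Fin m → ZMod 2) (f : Fin n → ZMod 2) : Fin m → ZMod 2 :=
  fun u => b u + (f (x u) + f (y u) + f (z u))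

/-- (F1) **Gauge**: flipping the variables in the support of `f` is a graph isomorphism
`FGLSS(b + ∂f) ≅ FGLSS(b)` — the CFI/Atserias–Dawar flip, here an honest isomorphism of graphs, so
`ckEquiv_of_consistencyFamily` applies with data `D (u, t) = {x u, y u, z u}` and the consistency
family `XorSystem.Good`. -/
theorem fglss_gauge (x y z : Fin m → Fin n) (b : Fin m → ZMod 2) (f : Fin n → ZMod 2) :
    Nonempty (fglss x y z (twist x y z b f) ≃g fglss x y z b) := by
  sorry

open scoped Classical in
/-- (F2) **Planted lower bound**: if `g` satisfies every equation then `Z(FGLSS(b), λ) ≥ (1+λ)^m`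
(choose any subset of the equations and take `g`'s local assignments). -/
theorem fglss_lower (x y z : Fin m → Fin n) (b : Fin m → ZMod 2) {lam : ℝ} (hlam : 0 ≤ lam)
    (g : Fin n → ZMod 2) (hg : ∀ u, g (x u) + g (y u) + g (z u) = b u) :
    (1 + lam) ^ m ≤ independencePolynomial (fglss x y z b) lam := by
  sorry

open scoped Classical in
/-- (F3) **Entropy upper bound**: if every total assignment satisfies at most `t` equations then
`Z(FGLSS(b), λ) ≤ 2^n (1+λ)^t` (an independent set is a consistent partial assignment plus a set of
equations it satisfies; extend it to a total assignment). Needs three distinct variables per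
equation. -/
theorem fglss_upper (x y z : Fin m → Fin n) (b : Fin m → ZMod 2) {lam : ℝ} (hlam : 0 ≤ lam)
    (hwf : ∀ u, x u ≠ y u ∧ x u ≠ z u ∧ y u ≠ z u) {t : ℕ}
    (ht : ∀ g : Fin n → ZMod 2, (Finset.univ.filter fun u => g (x u) + g (y u) + g (z u) = b u).card ≤ t) :
    independencePolynomial (fglss x y z b) lam ≤ 2 ^ n * (1 + lam) ^ t := by
  sorry

open scoped Classical in
/-- (F4) **Degree**: with at most `r ≥ 1` occurrences per variable the conflict graph has maximum
degree `≤ 6 r - 3` (three clique neighbours, and for each of the three positions at most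
`2 (r - 1)` conflicting local assignments). -/
theorem fglss_maxDegree (x y z : Fin m → Fin n) (b : Fin m → ZMod 2) {r : ℕ} (hr : 1 ≤ r)
    (hocc : ∀ v : Fin n,
      (Finset.univ.filter fun u => x u = v ∨ y u = v ∨ z u = v).card ≤ r) :
    (fglss x y z b).maxDegree ≤ 6 * r - 3 := by
  sorry

end FGLSS

end Summit.PneNP.PneNP.Cruxes.MacroscopicTwinsAbove.Sketch
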